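import Summits.Ventures.HodgeRepro.TwistedQuadAllCore

/-!
# Route-2's Theorem T (i), `ε = −`, for EVERY even `k ≥ 4` — one kernel theorem

Blind re-derivation cell `pub-hodge-repro`, seat `p1` (gen 12).  The `ε = −` companion of `TwistedQuadAllPos.lean`:
`v` of order `4j`, `c = v^{2j}`, an involution `u ∉ ⟨v⟩` with `u v u⁻¹ = c v⁻¹ = v^{2j−1}`; the uniform family (tfamily.py,
verified for `k = 4, …, 16`) is `f₁(a) = [a < 2j]` on the `u`-coset and `f₀(a) = [a odd] ⊕ [a ≥ 2j] ⊕ [a ∈ {2j−1, 4j−1}]` on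
`⟨v⟩` (`patN`), the three local conditions are proved symbolically exactly as in the `ε = +` file (the witness points are
`1, v, v^{2j−1}`), and `exists_twistedRectQuad_neg` is route-2's Theorem T (i), `ε = −`, in full generality.
-/

set_option autoImplicit false

open Finset Multiplicative
open scoped Pointwise

namespace HodgeRepro.TwistedQuadGen

open HodgeRepro.CosetQuad

variable (j : ℕ) [NeZero j]

/-! ### The multiplier `s = 2j + 1` -/

/-- `s = 2j − 1 ∈ ℤ/4j`. -/
def sNeg : ZMod (4 * j) := ((2 * j - 1 : ℕ) : ZMod (4 * j))

omit [NeZero j] in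
/-- `4j = 0` in `ℤ/4j`. -/
theorem neg_four_j_cast : ((4 * j : ℕ) : ZMod (4 * j)) = 0 := ZMod.natCast_self _

/-- `s² = 1`. -/
theorem sNeg_sq : sNeg j * sNeg j = 1 := by
  obtain ⟨j', rfl⟩ : ∃ j', j = j' + 1 := ⟨j - 1, by have := NeZero.ne j; omega⟩
  rw [sNeg, show 2 * (j' + 1) - 1 = 2 * j' + 1 by omega, ← Nat.cast_mul,
    show (2 * j' + 1) * (2 * j' + 1) = (4 * (j' + 1)) * j' + 1 by ring, Nat.cast_add, Nat.cast_mul,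
    neg_four_j_cast, zero_mul, zero_add, Nat.cast_one]

omit [NeZero j] in
/-- `(2j − 1).val = 2j − 1`. -/
theorem sNeg_val (hj : 1 ≤ j) : (sNeg j).val = 2 * j - 1 := val_natCast_lt _ (by omega)

/-- `s · 2j = 2j` in `ℤ/4j`. -/
theorem sNeg_mul_half : sNeg j * ((2 * j : ℕ) : ZMod (4 * j)) = ((2 * j : ℕ) : ZMod (4 * j)) := by
  obtain ⟨j', rfl⟩ : ∃ j', j = j' + 1 := ⟨j - 1, by have := NeZero.ne j; omega⟩
  rw [sNeg, show 2 * (j' + 1) - 1 = 2 * j' + 1 by omega, ← Nat.cast_mul,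
    show (2 * j' + 1) * (2 * (j' + 1)) = (4 * (j' + 1)) * j' + 2 * (j' + 1) by ring, Nat.cast_add, Nat.cast_mul,
    neg_four_j_cast, zero_mul, zero_add]

omit [NeZero j] in
/-- `−s = 2j + 1` in `ℤ/4j` (for `j ≥ 1`). -/
theorem neg_sNeg (hj : 1 ≤ j) : -sNeg j = ((2 * j + 1 : ℕ) : ZMod (4 * j)) := by
  apply neg_eq_of_add_eq_zero_right
  rw [sNeg, ← Nat.cast_add, show 2 * j - 1 + (2 * j + 1) = 4 * j by omega, neg_four_j_cast]

omit [NeZero j] in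
/-- `−1 = 4j − 1` in `ℤ/4j` (for `j ≥ 1`). -/
theorem neg_neg_one_cast (hj : 1 ≤ j) : (-1 : ZMod (4 * j)) = ((4 * j - 1 : ℕ) : ZMod (4 * j)) := by
  apply neg_eq_of_add_eq_zero_right
  rw [← Nat.cast_one, ← Nat.cast_add, show 1 + (4 * j - 1) = 4 * j by omega, neg_four_j_cast]

/-! ### `val` of the shifted points -/

/-- Every `a ∈ ℤ/4j` is the cast of a natural number `i < 4j`. -/
theorem neg_exists_natCast_eq (a : ZMod (4 * j)) : ∃ i : ℕ, i < 4 * j ∧ a = ((i : ℕ) : ZMod (4 * j)) :=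
  ⟨a.val, ZMod.val_lt a, (ZMod.natCast_zmod_val a).symm⟩

/-- `(a + 2j).val`. -/
theorem neg_val_add_half (a : ZMod (4 * j)) :
    (a + ((2 * j : ℕ) : ZMod (4 * j))).val = if a.val < 2 * j then a.val + 2 * j else a.val - 2 * j := by
  obtain ⟨i, hi, rfl⟩ := neg_exists_natCast_eq j a
  rw [← Nat.cast_add, val_natCast_lt _ hi]
  split_ifs with h
  · exact val_natCast_lt _ (by omega)
  · rw [val_natCast_sub _ (by omega) (by omega)]; omega

/-- `(a − 1).val`. -/
theorem neg_val_sub_one (hj : 1 ≤ j) (a : ZMod (4 * j)) :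
    (a - 1).val = if a.val = 0 then 4 * j - 1 else a.val - 1 := by
  obtain ⟨i, hi, rfl⟩ := neg_exists_natCast_eq j a
  rw [sub_eq_add_neg, neg_neg_one_cast j hj, ← Nat.cast_add, val_natCast_lt _ hi]
  split_ifs with h
  · rw [h, zero_add]; exact val_natCast_lt _ (by omega)
  · rw [val_natCast_sub _ (by omega) (by omega)]; omega

/-- `(a − s).val` for `s = 2j − 1`. -/
theorem val_sub_sNeg (hj : 1 ≤ j) (a : ZMod (4 * j)) :
    (a - sNeg j).val = if a.val + 2 * j + 1 < 4 * j then a.val + 2 * j + 1 else a.val + 2 * j + 1 - 4 * j := by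
  obtain ⟨i, hi, rfl⟩ := neg_exists_natCast_eq j a
  rw [sub_eq_add_neg, neg_sNeg j hj, ← Nat.cast_add, val_natCast_lt _ hi]
  split_ifs with h
  · rw [val_natCast_lt _ (by omega)]; omega
  · rw [val_natCast_sub _ (by omega) (by omega)]; omega

/-! ### The pattern -/

/-- The `⟨v⟩`-layer pattern `f₀(a) = [a odd] ⊕ [a ≥ 2j] ⊕ [a ∈ {2j−1, 4j−1}]`. -/
def patN0 (i : ℕ) : Prop :=
  (((i % 2 = 1 ∧ i < 2 * j) ∨ (i % 2 = 0 ∧ 2 * j ≤ i)) ∧ ¬ (i = 2 * j - 1 ∨ i = 4 * j - 1)) ∨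
    (¬ ((i % 2 = 1 ∧ i < 2 * j) ∨ (i % 2 = 0 ∧ 2 * j ≤ i)) ∧ (i = 2 * j - 1 ∨ i = 4 * j - 1))

/-- The predicate `(patN0 j)` is decidable. -/
instance : DecidablePred (patN0 j) := fun i => by unfold patN0; infer_instance

/-- The pattern on the model: `f₁ = [a < 2j]` on the `u`-coset, `f₀ = patN0` on `⟨v⟩`. -/
def patN (p : TwistGroup (4 * j) (sNeg j) (sNeg_sq j)) : Prop :=
  (p.right = ofAdd 1 ∧ (toAdd p.left).val < 2 * j) ∨ (p.right = ofAdd 0 ∧ patN0 j (toAdd p.left).val)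

/-- The predicate `(patN j)` is decidable. -/
instance : DecidablePred (patN j) := fun p => by unfold patN; infer_instance

/-- The CM type of the model: the elements satisfying the pattern. -/
def ΦNeg : Finset (TwistGroup (4 * j) (sNeg j) (sNeg_sq j)) := univ.filter (patN j)

/-- Membership in `ΦNeg` on the `⟨v⟩`-layer. -/
theorem mem_ΦNeg_zero (a : ZMod (4 * j)) :
    mk (4 * j) (sNeg j) (sNeg_sq j) a 0 ∈ ΦNeg j ↔ patN0 j a.val := by
  rw [ΦNeg, Finset.mem_filter]
  have h01 : (ofAdd (0 : ZMod 2) : Multiplicative (ZMod 2)) ≠ ofAdd 1 := by decide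
  simp only [Finset.mem_univ, true_and, patN, mk, toAdd_ofAdd, h01, false_and, false_or, true_and]

/-- Membership in `ΦNeg` on the `u`-coset. -/
theorem mem_ΦNeg_one (a : ZMod (4 * j)) :
    mk (4 * j) (sNeg j) (sNeg_sq j) a 1 ∈ ΦNeg j ↔ a.val < 2 * j := by
  rw [ΦNeg, Finset.mem_filter]
  have h10 : (ofAdd (1 : ZMod 2) : Multiplicative (ZMod 2)) ≠ ofAdd 0 := by decide
  simp only [Finset.mem_univ, true_and, patN, mk, toAdd_ofAdd, h10, false_and, or_false, true_and]

/-! ### The four memberships around a point -/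

/-- `c = mk 2j 0` on the model `ℤ/4j ⋊ ℤ/2`. -/
theorem tc_neg_eq : tc (4 * j) (sNeg j) (sNeg_sq j) = mk (4 * j) (sNeg j) (sNeg_sq j) ((2 * j : ℕ) : ZMod (4 * j)) 0 := by
  rw [tc_eq_mk, show (4 * j) / 2 = 2 * j by omega]

/-- `mk a g * c = mk (a + 2j) g` (both layers). -/
theorem mk_mul_tc_neg (a : ZMod (4 * j)) (g : ZMod 2) :
    mk (4 * j) (sNeg j) (sNeg_sq j) a g * tc (4 * j) (sNeg j) (sNeg_sq j) =
      mk (4 * j) (sNeg j) (sNeg_sq j) (a + ((2 * j : ℕ) : ZMod (4 * j))) g := by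
  rw [tc_neg_eq, mk_mul, add_zero]
  rcases (show ∀ y : ZMod 2, y = 0 ∨ y = 1 by decide) g with rfl | rfl
  · rw [ZMod.val_zero, pow_zero, one_mul]
  · rw [val_one_two, pow_one, sNeg_mul_half]

/-- The membership predicates at distance `0, u, v, vu` from a `⟨v⟩`-point with value `n`. -/
def neg_M2 (n : ℕ) : Prop := patN0 j (if n = 0 then 4 * j - 1 else n - 1)

/-- The predicate `(neg_M2 j)` is decidable. -/
instance : DecidablePred (neg_M2 j) := fun n => by unfold neg_M2; infer_instance

/-- The fourth membership predicate: the `vu`-neighbour lies on the `u`-coset. -/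
def neg_M3 (n : ℕ) : Prop := (if n + 2 * j + 1 < 4 * j then n + 2 * j + 1 else n + 2 * j + 1 - 4 * j) < 2 * j

/-- The predicate `(neg_M3 j)` is decidable. -/
instance : DecidablePred (neg_M3 j) := fun n => by unfold neg_M3; infer_instance

/-- The four memberships around `mk a 0`. -/
theorem neg_mems_zero (hj : 1 ≤ j) (a : ZMod (4 * j)) :
    (mk (4 * j) (sNeg j) (sNeg_sq j) a 0 * (rectT (4 * j) (sNeg j) (sNeg_sq j) 0)⁻¹ ∈ ΦNeg j ↔ patN0 j a.val) ∧
    (mk (4 * j) (sNeg j) (sNeg_sq j) a 0 * (rectT (4 * j) (sNeg j) (sNeg_sq j) 1)⁻¹ ∈ ΦNeg j ↔ a.val < 2 * j) ∧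
    (mk (4 * j) (sNeg j) (sNeg_sq j) a 0 * (rectT (4 * j) (sNeg j) (sNeg_sq j) 2)⁻¹ ∈ ΦNeg j ↔ neg_M2 j a.val) ∧
    (mk (4 * j) (sNeg j) (sNeg_sq j) a 0 * (rectT (4 * j) (sNeg j) (sNeg_sq j) 3)⁻¹ ∈ ΦNeg j ↔ neg_M3 j a.val) := by
  refine ⟨?_, ?_, ?_, ?_⟩
  · rw [mk_mul_rectT_inv_zero, mem_ΦNeg_zero]
  · rw [mk_mul_rectT_inv_one, zero_add, mem_ΦNeg_one]
  · rw [mk_mul_rectT_inv_two, ZMod.val_zero, pow_zero, mem_ΦNeg_zero, neg_val_sub_one j hj]; rfl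
  · rw [mk_mul_rectT_inv_three, sub_zero, val_one_two, pow_one, zero_add, mem_ΦNeg_one, val_sub_sNeg j hj]; rfl

/-- The four memberships around `mk a 1`. -/
theorem neg_mems_one (hj : 1 ≤ j) (a : ZMod (4 * j)) :
    (mk (4 * j) (sNeg j) (sNeg_sq j) a 1 * (rectT (4 * j) (sNeg j) (sNeg_sq j) 0)⁻¹ ∈ ΦNeg j ↔ a.val < 2 * j) ∧
    (mk (4 * j) (sNeg j) (sNeg_sq j) a 1 * (rectT (4 * j) (sNeg j) (sNeg_sq j) 1)⁻¹ ∈ ΦNeg j ↔ patN0 j a.val) ∧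
    (mk (4 * j) (sNeg j) (sNeg_sq j) a 1 * (rectT (4 * j) (sNeg j) (sNeg_sq j) 2)⁻¹ ∈ ΦNeg j ↔ neg_M3 j a.val) ∧
    (mk (4 * j) (sNeg j) (sNeg_sq j) a 1 * (rectT (4 * j) (sNeg j) (sNeg_sq j) 3)⁻¹ ∈ ΦNeg j ↔ neg_M2 j a.val) := by
  have h11 : (1 : ZMod 2) + 1 = 0 := by decide
  refine ⟨?_, ?_, ?_, ?_⟩
  · rw [mk_mul_rectT_inv_zero, mem_ΦNeg_one]
  · rw [mk_mul_rectT_inv_one, h11, mem_ΦNeg_zero]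
  · rw [mk_mul_rectT_inv_two, val_one_two, pow_one, mem_ΦNeg_one, val_sub_sNeg j hj]; rfl
  · rw [mk_mul_rectT_inv_three, sub_self, ZMod.val_zero, pow_zero, h11, mem_ΦNeg_zero, neg_val_sub_one j hj]; rfl

/-! ### The three local conditions -/

/-- CM: `p c ∈ Φ ↔ p ∉ Φ`. -/
theorem cm_neg (p : TwistGroup (4 * j) (sNeg j) (sNeg_sq j)) :
    p * tc (4 * j) (sNeg j) (sNeg_sq j) ∈ ΦNeg j ↔ ¬ p ∈ ΦNeg j := by
  obtain ⟨l, r⟩ := p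
  obtain ⟨a, rfl⟩ := ofAdd.surjective l
  obtain ⟨g, rfl⟩ := ofAdd.surjective r
  show mk (4 * j) (sNeg j) (sNeg_sq j) a g * tc (4 * j) (sNeg j) (sNeg_sq j) ∈ ΦNeg j ↔
    ¬ mk (4 * j) (sNeg j) (sNeg_sq j) a g ∈ ΦNeg j
  rw [mk_mul_tc_neg]
  have hv : a.val < 4 * j := ZMod.val_lt a
  rcases (show ∀ y : ZMod 2, y = 0 ∨ y = 1 by decide) g with rfl | rfl
  · rw [mem_ΦNeg_zero, mem_ΦNeg_zero, neg_val_add_half]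
    unfold patN0
    split_ifs <;> omega
  · rw [mem_ΦNeg_one, mem_ΦNeg_one, neg_val_add_half]
    split_ifs <;> omega

/-- `SumTwo`: exactly two of the four neighbours of every point lie in `Φ`. -/
theorem sumTwo_neg (hj : 1 ≤ j) (p : TwistGroup (4 * j) (sNeg j) (sNeg_sq j)) :
    (univ.filter fun i : Fin 4 => p * (rectT (4 * j) (sNeg j) (sNeg_sq j) i)⁻¹ ∈ ΦNeg j).card = 2 := by
  obtain ⟨l, r⟩ := p
  obtain ⟨a, rfl⟩ := ofAdd.surjective l
  obtain ⟨g, rfl⟩ := ofAdd.surjective r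
  have e : (⟨ofAdd a, ofAdd g⟩ : TwistGroup (4 * j) (sNeg j) (sNeg_sq j)) =
      mk (4 * j) (sNeg j) (sNeg_sq j) a g := rfl
  rw [e, Finset.card_filter, Fin.sum_univ_four]
  have hv : a.val < 4 * j := ZMod.val_lt a
  rcases (show ∀ y : ZMod 2, y = 0 ∨ y = 1 by decide) g with rfl | rfl
  · obtain ⟨h0, h1, h2, h3⟩ := neg_mems_zero j hj a
    rw [if_congr h0 rfl rfl, if_congr h1 rfl rfl, if_congr h2 rfl rfl, if_congr h3 rfl rfl]
    unfold neg_M2 neg_M3 patN0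
    split_ifs <;> omega
  · obtain ⟨h0, h1, h2, h3⟩ := neg_mems_one j hj a
    rw [if_congr h0 rfl rfl, if_congr h1 rfl rfl, if_congr h2 rfl rfl, if_congr h3 rfl rfl]
    unfold neg_M2 neg_M3 patN0
    split_ifs <;> omega

/-- The membership predicate at distance `t_k` from a `⟨v⟩`-point of value `n`. -/
def neg_Mk (k : Fin 4) (n : ℕ) : Prop :=
  match k with
  | 0 => patN0 j n
  | 1 => n < 2 * j
  | 2 => neg_M2 j n
  | 3 => neg_M3 j n

/-- `neg_mems_zero` indexed by `k`. -/
theorem neg_mem_mk_zero (hj : 1 ≤ j) (a : ZMod (4 * j)) (k : Fin 4) :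
    mk (4 * j) (sNeg j) (sNeg_sq j) a 0 * (rectT (4 * j) (sNeg j) (sNeg_sq j) k)⁻¹ ∈ ΦNeg j ↔ neg_Mk j k a.val := by
  obtain ⟨h0, h1, h2, h3⟩ := neg_mems_zero j hj a
  have hfin : ∀ x : Fin 4, x = 0 ∨ x = 1 ∨ x = 2 ∨ x = 3 := by decide
  rcases hfin k with rfl | rfl | rfl | rfl
  · exact h0
  · exact h1
  · exact h2
  · exact h3

/-- A `⟨v⟩`-point `a` separating `Φ t_k` from `c Φ t_i` refutes the conjugate pair `(i, k)`. -/
theorem neg_sep_of (hj : 1 ≤ j) (a : ZMod (4 * j)) (i k : Fin 4)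
    (h : ¬ (neg_Mk j k a.val ↔ neg_Mk j i (a + ((2 * j : ℕ) : ZMod (4 * j))).val)) :
    ¬ ∀ q : TwistGroup (4 * j) (sNeg j) (sNeg_sq j),
      (q * (rectT (4 * j) (sNeg j) (sNeg_sq j) k)⁻¹ ∈ ΦNeg j ↔
        q * (tc (4 * j) (sNeg j) (sNeg_sq j) * (rectT (4 * j) (sNeg j) (sNeg_sq j) i)⁻¹) ∈ ΦNeg j) := by
  intro hall
  apply h
  have := hall (mk (4 * j) (sNeg j) (sNeg_sq j) a 0)
  rwa [← mul_assoc, mk_mul_tc_neg, neg_mem_mk_zero j hj, neg_mem_mk_zero j hj] at this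

/-- The values of the witness points `1, v, v^{2j−1}` and of their `c`-translates. -/
theorem neg_witness_vals (hj : 2 ≤ j) :
    ((0 : ZMod (4 * j)).val = 0 ∧ ((1 : ℕ) : ZMod (4 * j)).val = 1 ∧
      ((2 * j - 1 : ℕ) : ZMod (4 * j)).val = 2 * j - 1) ∧
    (((0 : ZMod (4 * j)) + ((2 * j : ℕ) : ZMod (4 * j))).val = 2 * j ∧
      (((1 : ℕ) : ZMod (4 * j)) + ((2 * j : ℕ) : ZMod (4 * j))).val = 2 * j + 1 ∧
      (((2 * j - 1 : ℕ) : ZMod (4 * j)) + ((2 * j : ℕ) : ZMod (4 * j))).val = 4 * j - 1) := by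
  have h0 : (0 : ZMod (4 * j)).val = 0 := ZMod.val_zero
  have h1 : ((1 : ℕ) : ZMod (4 * j)).val = 1 := val_natCast_lt _ (by omega)
  have h2 : ((2 * j - 1 : ℕ) : ZMod (4 * j)).val = 2 * j - 1 := val_natCast_lt _ (by omega)
  refine ⟨⟨h0, h1, h2⟩, ?_, ?_, ?_⟩ <;> rw [neg_val_add_half] <;> simp only [h0, h1, h2] <;> split_ifs <;> omega

set_option linter.unusedSimpArgs false in
set_option linter.unusedTactic false in
set_option linter.unnecessarySeqFocus false in
set_option linter.unreachableTactic false in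
/-- No conjugate pair: for every `(i, k)` one of the points `1, v, v²` separates `Φ t_k` from `c Φ t_i`. -/
theorem noConj_neg (hj : 2 ≤ j) (i k : Fin 4) :
    ¬ ∀ q : TwistGroup (4 * j) (sNeg j) (sNeg_sq j),
      (q * (rectT (4 * j) (sNeg j) (sNeg_sq j) k)⁻¹ ∈ ΦNeg j ↔
        q * (tc (4 * j) (sNeg j) (sNeg_sq j) * (rectT (4 * j) (sNeg j) (sNeg_sq j) i)⁻¹) ∈ ΦNeg j) := by
  have hj1 : 1 ≤ j := by omega
  obtain ⟨⟨v0, v1, v2⟩, w0, w1, w2⟩ := neg_witness_vals j hj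
  have hfin : ∀ x : Fin 4, x = 0 ∨ x = 1 ∨ x = 2 ∨ x = 3 := by decide
  rcases hfin i with rfl | rfl | rfl | rfl <;> rcases hfin k with rfl | rfl | rfl | rfl
  · exact neg_sep_of j hj1 (0 : ZMod (4 * j)) 0 0 (by simp only [neg_Mk, neg_M2, neg_M3, patN0, v0, w0]; (try simp only [true_and, and_true, false_and, and_false, true_or, or_true, false_or, or_false, not_true_eq_false, not_false_eq_true, not_not, iff_true, true_iff, iff_false, false_iff]) <;> first | (intro h; rw [iff_iff_and_or_not_and_not] at h; (try split_ifs at h) <;> omega) | (intro h; exact absurd (h.mpr (by (try split_ifs) <;> omega)) (by (try split_ifs) <;> omega)) | (intro h; exact absurd (h.mp (by (try split_ifs) <;> omega)) (by (try split_ifs) <;> omega)))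
  · exact neg_sep_of j hj1 ((1 : ℕ) : ZMod (4 * j)) 0 1 (by simp only [neg_Mk, neg_M2, neg_M3, patN0, v1, w1]; (try simp only [true_and, and_true, false_and, and_false, true_or, or_true, false_or, or_false, not_true_eq_false, not_false_eq_true, not_not, iff_true, true_iff, iff_false, false_iff]) <;> first | (intro h; rw [iff_iff_and_or_not_and_not] at h; (try split_ifs at h) <;> omega) | (intro h; exact absurd (h.mpr (by (try split_ifs) <;> omega)) (by (try split_ifs) <;> omega)) | (intro h; exact absurd (h.mp (by (try split_ifs) <;> omega)) (by (try split_ifs) <;> omega)))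
  · exact neg_sep_of j hj1 ((2 * j - 1 : ℕ) : ZMod (4 * j)) 0 2 (by simp only [neg_Mk, neg_M2, neg_M3, patN0, v2, w2]; (try simp only [true_and, and_true, false_and, and_false, true_or, or_true, false_or, or_false, not_true_eq_false, not_false_eq_true, not_not, iff_true, true_iff, iff_false, false_iff]) <;> first | (intro h; rw [iff_iff_and_or_not_and_not] at h; (try split_ifs at h) <;> omega) | (intro h; exact absurd (h.mpr (by (try split_ifs) <;> omega)) (by (try split_ifs) <;> omega)) | (intro h; exact absurd (h.mp (by (try split_ifs) <;> omega)) (by (try split_ifs) <;> omega)))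
  · exact neg_sep_of j hj1 (0 : ZMod (4 * j)) 0 3 (by simp only [neg_Mk, neg_M2, neg_M3, patN0, v0, w0]; (try simp only [true_and, and_true, false_and, and_false, true_or, or_true, false_or, or_false, not_true_eq_false, not_false_eq_true, not_not, iff_true, true_iff, iff_false, false_iff]) <;> first | (intro h; rw [iff_iff_and_or_not_and_not] at h; (try split_ifs at h) <;> omega) | (intro h; exact absurd (h.mpr (by (try split_ifs) <;> omega)) (by (try split_ifs) <;> omega)) | (intro h; exact absurd (h.mp (by (try split_ifs) <;> omega)) (by (try split_ifs) <;> omega)))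
  · exact neg_sep_of j hj1 ((1 : ℕ) : ZMod (4 * j)) 1 0 (by simp only [neg_Mk, neg_M2, neg_M3, patN0, v1, w1]; (try simp only [true_and, and_true, false_and, and_false, true_or, or_true, false_or, or_false, not_true_eq_false, not_false_eq_true, not_not, iff_true, true_iff, iff_false, false_iff]) <;> first | (intro h; rw [iff_iff_and_or_not_and_not] at h; (try split_ifs at h) <;> omega) | (intro h; exact absurd (h.mpr (by (try split_ifs) <;> omega)) (by (try split_ifs) <;> omega)) | (intro h; exact absurd (h.mp (by (try split_ifs) <;> omega)) (by (try split_ifs) <;> omega)))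
  · exact neg_sep_of j hj1 (0 : ZMod (4 * j)) 1 1 (by simp only [neg_Mk, neg_M2, neg_M3, patN0, v0, w0]; (try simp only [true_and, and_true, false_and, and_false, true_or, or_true, false_or, or_false, not_true_eq_false, not_false_eq_true, not_not, iff_true, true_iff, iff_false, false_iff]) <;> first | (intro h; rw [iff_iff_and_or_not_and_not] at h; (try split_ifs at h) <;> omega) | (intro h; exact absurd (h.mpr (by (try split_ifs) <;> omega)) (by (try split_ifs) <;> omega)) | (intro h; exact absurd (h.mp (by (try split_ifs) <;> omega)) (by (try split_ifs) <;> omega)))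
  · exact neg_sep_of j hj1 (0 : ZMod (4 * j)) 1 2 (by simp only [neg_Mk, neg_M2, neg_M3, patN0, v0, w0]; (try simp only [true_and, and_true, false_and, and_false, true_or, or_true, false_or, or_false, not_true_eq_false, not_false_eq_true, not_not, iff_true, true_iff, iff_false, false_iff]) <;> first | (intro h; rw [iff_iff_and_or_not_and_not] at h; (try split_ifs at h) <;> omega) | (intro h; exact absurd (h.mpr (by (try split_ifs) <;> omega)) (by (try split_ifs) <;> omega)) | (intro h; exact absurd (h.mp (by (try split_ifs) <;> omega)) (by (try split_ifs) <;> omega)))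
  · exact neg_sep_of j hj1 ((2 * j - 1 : ℕ) : ZMod (4 * j)) 1 3 (by simp only [neg_Mk, neg_M2, neg_M3, patN0, v2, w2]; (try simp only [true_and, and_true, false_and, and_false, true_or, or_true, false_or, or_false, not_true_eq_false, not_false_eq_true, not_not, iff_true, true_iff, iff_false, false_iff]) <;> first | (intro h; rw [iff_iff_and_or_not_and_not] at h; (try split_ifs at h) <;> omega) | (intro h; exact absurd (h.mpr (by (try split_ifs) <;> omega)) (by (try split_ifs) <;> omega)) | (intro h; exact absurd (h.mp (by (try split_ifs) <;> omega)) (by (try split_ifs) <;> omega)))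
  · exact neg_sep_of j hj1 ((2 * j - 1 : ℕ) : ZMod (4 * j)) 2 0 (by simp only [neg_Mk, neg_M2, neg_M3, patN0, v2, w2]; (try simp only [true_and, and_true, false_and, and_false, true_or, or_true, false_or, or_false, not_true_eq_false, not_false_eq_true, not_not, iff_true, true_iff, iff_false, false_iff]) <;> first | (intro h; rw [iff_iff_and_or_not_and_not] at h; (try split_ifs at h) <;> omega) | (intro h; exact absurd (h.mpr (by (try split_ifs) <;> omega)) (by (try split_ifs) <;> omega)) | (intro h; exact absurd (h.mp (by (try split_ifs) <;> omega)) (by (try split_ifs) <;> omega)))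
  · exact neg_sep_of j hj1 (0 : ZMod (4 * j)) 2 1 (by simp only [neg_Mk, neg_M2, neg_M3, patN0, v0, w0]; (try simp only [true_and, and_true, false_and, and_false, true_or, or_true, false_or, or_false, not_true_eq_false, not_false_eq_true, not_not, iff_true, true_iff, iff_false, false_iff]) <;> first | (intro h; rw [iff_iff_and_or_not_and_not] at h; (try split_ifs at h) <;> omega) | (intro h; exact absurd (h.mpr (by (try split_ifs) <;> omega)) (by (try split_ifs) <;> omega)) | (intro h; exact absurd (h.mp (by (try split_ifs) <;> omega)) (by (try split_ifs) <;> omega)))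
  · exact neg_sep_of j hj1 (0 : ZMod (4 * j)) 2 2 (by simp only [neg_Mk, neg_M2, neg_M3, patN0, v0, w0]; (try simp only [true_and, and_true, false_and, and_false, true_or, or_true, false_or, or_false, not_true_eq_false, not_false_eq_true, not_not, iff_true, true_iff, iff_false, false_iff]) <;> first | (intro h; rw [iff_iff_and_or_not_and_not] at h; (try split_ifs at h) <;> omega) | (intro h; exact absurd (h.mpr (by (try split_ifs) <;> omega)) (by (try split_ifs) <;> omega)) | (intro h; exact absurd (h.mp (by (try split_ifs) <;> omega)) (by (try split_ifs) <;> omega)))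
  · exact neg_sep_of j hj1 ((1 : ℕ) : ZMod (4 * j)) 2 3 (by simp only [neg_Mk, neg_M2, neg_M3, patN0, v1, w1]; (try simp only [true_and, and_true, false_and, and_false, true_or, or_true, false_or, or_false, not_true_eq_false, not_false_eq_true, not_not, iff_true, true_iff, iff_false, false_iff]) <;> first | (intro h; rw [iff_iff_and_or_not_and_not] at h; (try split_ifs at h) <;> omega) | (intro h; exact absurd (h.mpr (by (try split_ifs) <;> omega)) (by (try split_ifs) <;> omega)) | (intro h; exact absurd (h.mp (by (try split_ifs) <;> omega)) (by (try split_ifs) <;> omega)))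
  · exact neg_sep_of j hj1 (0 : ZMod (4 * j)) 3 0 (by simp only [neg_Mk, neg_M2, neg_M3, patN0, v0, w0]; (try simp only [true_and, and_true, false_and, and_false, true_or, or_true, false_or, or_false, not_true_eq_false, not_false_eq_true, not_not, iff_true, true_iff, iff_false, false_iff]) <;> first | (intro h; rw [iff_iff_and_or_not_and_not] at h; (try split_ifs at h) <;> omega) | (intro h; exact absurd (h.mpr (by (try split_ifs) <;> omega)) (by (try split_ifs) <;> omega)) | (intro h; exact absurd (h.mp (by (try split_ifs) <;> omega)) (by (try split_ifs) <;> omega)))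
  · exact neg_sep_of j hj1 ((2 * j - 1 : ℕ) : ZMod (4 * j)) 3 1 (by simp only [neg_Mk, neg_M2, neg_M3, patN0, v2, w2]; (try simp only [true_and, and_true, false_and, and_false, true_or, or_true, false_or, or_false, not_true_eq_false, not_false_eq_true, not_not, iff_true, true_iff, iff_false, false_iff]) <;> first | (intro h; rw [iff_iff_and_or_not_and_not] at h; (try split_ifs at h) <;> omega) | (intro h; exact absurd (h.mpr (by (try split_ifs) <;> omega)) (by (try split_ifs) <;> omega)) | (intro h; exact absurd (h.mp (by (try split_ifs) <;> omega)) (by (try split_ifs) <;> omega)))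
  · exact neg_sep_of j hj1 ((1 : ℕ) : ZMod (4 * j)) 3 2 (by simp only [neg_Mk, neg_M2, neg_M3, patN0, v1, w1]; simp only [show ¬ ((1 : ℕ) = 0) by omega, show ¬ (2 * j + 1 + 2 * j + 1 < 4 * j) by omega, if_false]; intro h; exact absurd (h.mpr (by omega)) (by omega))
  · exact neg_sep_of j hj1 (0 : ZMod (4 * j)) 3 3 (by simp only [neg_Mk, neg_M2, neg_M3, patN0, v0, w0]; (try simp only [true_and, and_true, false_and, and_false, true_or, or_true, false_or, or_false, not_true_eq_false, not_false_eq_true, not_not, iff_true, true_iff, iff_false, false_iff]) <;> first | (intro h; rw [iff_iff_and_or_not_and_not] at h; (try split_ifs at h) <;> omega) | (intro h; exact absurd (h.mpr (by (try split_ifs) <;> omega)) (by (try split_ifs) <;> omega)) | (intro h; exact absurd (h.mp (by (try split_ifs) <;> omega)) (by (try split_ifs) <;> omega)))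

/-! ### The theorem -/

/-- **Theorem T (i), `ε = −`, for EVERY even `k = 2j ≥ 4` (route-2 §9.39; kernel existence).**  For every finite
`(G, c)`, `v` of order `4j` with `v^{2j} = c` and an involution `u ∉ ⟨v⟩` with `u v u⁻¹ = v^{2j−1}` (`= c v⁻¹`): some
CM type has the twisted rectangle `Φ, Φu, Φv, Φ(vu)` `SumTwo` without a conjugate pair. -/
theorem exists_twistedRectQuad_neg {G : Type*} [Group G] [Fintype G] [DecidableEq G] (hj : 2 ≤ j) {c : G}
    (hc : IsComplexConj c) (v u : G) (hv : orderOf v = 4 * j) (hu : u ^ 2 = 1)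
    (huv : u * v * u⁻¹ = v ^ (2 * j - 1)) (hnot : u ∉ Subgroup.zpowers v) (hcj : v ^ (2 * j) = c) :
    ∃ Φ : Finset G, IsCMType c Φ ∧ SumTwo (fun i => rmul Φ (![1, u, v, v * u] i)) ∧
      ∀ i k : Fin 4, rmul Φ (![1, u, v, v * u] k) ≠ c • rmul Φ (![1, u, v, v * u] i) :=
  exists_twistedRectQuad_of_model (4 * j) hc v u (hs := sNeg_sq j) (by omega) hv hu
    (by rw [sNeg_val j (by omega)]; exact huv) hnot
    (by rw [show (4 * j) / 2 = 2 * j by omega]; exact hcj) (ΦNeg j)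
    (fun p => (decide_eq_decide.mpr (cm_neg j p)).trans decide_not)
    (fun p => by simp only [decide_eq_true_eq]; exact sumTwo_neg j (by omega) p)
    (fun i k h => noConj_neg j hj i k (fun p => by simpa only [decide_eq_true_eq] using h p))

end HodgeRepro.TwistedQuadGen
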